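import Literature.MathematicalPhysics.QuantumFieldTheory.Balaban1983to89.Node00.RegSetOfFibredChart
import Literature.MathematicalPhysics.QuantumFieldTheory.Balaban1983to89.Node00.Record13

/-!
# NODE N09 · (F3) OF THE P7 LOCATOR AUDIT — THE EVERYWHERE-ON-THE-DOMAIN EDITION ALONG A FIBRED CHART, AND THE LOG-AT-ZERO CORNER IT BUYS:
# along the displayed (2.10)-shaped chart sockets of `Node00.RegSetOfFibredChart` the β-transport of record of the (0.19) density `ρ_j` is STRICTLY POSITIVE at
# EVERY coarse field of the next small-field domain — the witness is print's own base point `B₁ = 0`, the critical configuration `V^{(j)}(W)` — and hence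
# `A_{j+1} = log 𝐍_j⁻¹ T_j ρ_j` is CONTINUOUS on that domain and `T_j ρ_j = 𝐍_j e^{A_{j+1}}` holds there (print's (0.19) sentence on the domain, `𝐍_j > 0`)

Cell `pub-ymgap` (YM-PLAN Track A), DAG node N09 [Balaban1987RG1] (= [I]); seat `pub-ymgap-dag-n09-w1` g5 (D-0149 width seat 1 of node N09); count-neutral helper
keyed to K1⁷ `StabilityBAtRecordR13SepCoPH` = stmt-QuantumFields-20542 (`--kind proof --supports … --as helper`).  HONEST FRAMING: kernel measure theory ∕ topology at
NODE 00's definitions BY NAME; NOTHING of Bałaban's analysis asserted; the chart is DISPLAYED, not constructed; N09 NOT discharged; K0⁷∕K1⁷ NOT closed; counts unmoved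
(typed 28∕28 · discharged 5∕27); one finite 𝕋⁴ programme at fixed ε — R4 closes the conditional rung `BalabanLadder.UV` only; the Yang–Mills mass gap (Clay) is NOT
proved by any of this; nothing continuum ∕ ℝ⁴ ∕ OS.

THE LOCATED DEBT.  K0e's `P7-LOCATOR-AUDIT.md` §4 lists three standard-analysis inputs behind N09's analytic binder `hreg`: (F1) the Jacobian face of (0.4)
(dag-n09-w2∕w4∕w6), (F2) level-set nullity (this lineage's g4), **(F3) POSITIVITY of `T_{k−1}ρ_{k−1}` on `domAlt_k`** («the log-at-zero corner … follows from (F1) +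
«fibre(W) meets domAlt_{k−1}»»).  g4 proved the FREE half (a.e. in the fine field, `…N09TransportPositiveAE`).  THIS FILE proves the EVERYWHERE-ON-THE-DOMAIN half in
the currency the (F1) doors display: a fibred chart `(Z, τ, Φ, J, S)` of the averaging of record over an open `U` (`Ū(Φ(V,z)) = V`, `dU⌊(Ū⁻¹U ∩ S) = Φ_*((dV⌊U ⊗ τ)·J)`)
makes `TcanOfRecord` (= `TβOfRecord₁₃`) EQUAL to the fibre integral `∫ J(V,z)·ρ(Φ(V,z)) dτ(z)` at every `V ∈ U` (dag-n09-w6 g2's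
`TcanOfRecord_eqOn_fibreIntegral_of_fibredChart`), so it is STRICTLY POSITIVE at `V` as soon as `τ` charges `{z | J(V,z)·ρ(Φ(V,z)) > 0}` — with `τ` open-positive: as
soon as the chart integrand is positive NEAR ONE fibre coordinate `z₀`.  For the β-input `ρ_j = χ^{(2.9)}_j·exp[−GF_j∕g_j² + A_j]` the witness is print's base point of
(2.10), `B₁ = 0`, i.e. `Φ(V, z₀) = V^{(j)}(V) = critCfgOfRecord θ.ν P.K j V`: ON THE SOLVABLE SET every fluctuation variable of the critical configuration is
`dist1 1 = 0 < ε₂₉` (`Node00.avg_critCfgOfRecord`), so `χ^{(2.9)}_j(V^{(j)}(V)) = 1`, and along the chart the deviations `z ↦ dist1(V^{(j)}(V)(b)⁻¹·Φ(V,z)(b))` are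
continuous, hence `< ε₂₉` near `z₀` (finitely many bonds).  THE CORNER IT BUYS (K0e `P7-EVERYWHERE-ANALYSIS.md` §2): `A_{j+1} = log(𝐍_j⁻¹·T_jρ_j)` is continuous on
`domAlt_{j+1}` from `hreg_j` (`continuousOn_TcanOfRecord` on the maximal regular set ⊇ `domAlt_{j+1}`) AND this positivity (`Real.log` is continuous off `0`) — the
`A_k∘Φ` part of the smooth-factor hypothesis `hg` of dag-n09-w6 g2's `continuousOn_fibreIntegral_betaInput_chiFixed29_of_thresholdNull` AT THE NEXT STEP: the (F1)
induction `k → k+1` reads (F3)_k.  And since `1 ∈ domAlt_{j+1}` (`0 < ν.ε₀`), `𝐍_j = T_jρ_j(1) > 0` and print's (0.19) sentence `T_jρ_j = 𝐍_j·e^{A_{j+1}}` holds AT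
EVERY POINT OF THE DOMAIN (lit-balaban r20's `normConst_mul_exp_nextAction`, whose two positivity hypotheses are exactly what this file produces).

WHAT IS PROVED (theorems only; 0 def; 0 sorry; axioms standard).  §1 GENERIC: `fibreIntegral_pos_of_measure_pos`, `measure_setOf_pos_of_eventually`,
`eventually_jacobian_mul_comp_pos`, `fibreIntegral_pos_of_eventually_pos`.  §2 AT THE RECORD, generic density (`k < K`, `ρ ≥ 0` integrable, w6's chart sockets + per-`V`
integrability): ★★ `TcanOfRecord_pos_on_of_fibredChart`, ★★ `TcanOfRecord_pos_on_of_fibredChart_of_eventually`.  §3 AT THE β-INPUT `ρ_k = betaInputOfRecord T (chiFixed29 ν ε₁) K g k`: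
`betaInput_chi29_apply ∕ _nonneg ∕ _pos_iff`, ★ `fluctDevOfRecord_critCfgOfRecord`, ★ `chiFix29OfRecord_critCfgOfRecord_eq_one` (general solvable `W`; dag-n13-w1's
`…_critCfgOfRecord_one` is the `W = 1` case), `betaInput_chi29_critCfgOfRecord_pos`, `fluctDevOfRecord_eq_of_avg_eq`, `continuousAt_fluctDevOfRecord_chart`,
★ `eventually_chiFix29OfRecord_chart_eq_one`, `eventually_betaInput_chi29_chart_pos`, ★★★ `TβOfRecord₁₃_betaInput_pos_on_domAlt_of_fibredChart`.  §4 THE CORNER: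
`continuousOn_nextAction_of_ne_zero`, ★★ `continuousOn_effActionHT_succ_of_subset_regSetOfRecord_of_pos`, ★★★ `continuousOn_effActionHT_succ_domAlt_of_fibredChart`,
★★ `normConstHT_pos_of_fibredChart`, ★★★ `TβOfRecord₁₃_betaInput_eq_normConst_mul_exp_effActionHT_on_domAlt` ((0.19) on the domain).

HONEST SCOPE.  (i) The chart `(Z, τ, Φ, J, S)` with `hΦ hJ havgΦ hmap`, per-`V` integrability `hintV`, the continuity `hgc`, the base point `z₀` (`Φ(V, z₀ V) = V^{(j)}(V)`,
`Φ(V,·)` continuous there, `J(V,·) > 0` nearby) are DISPLAYED — for [I]'s (2.10) chart: «`B₁ = 0` gives the critical configuration, the substitution is continuous in `B₁`,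
`σ(B′)·|∂B′∕∂B₁| > 0` at `B₁ = 0`»; constructing that chart at the record is the UNOWNED (M3r) of dag-n09-w6's `F1-CONSUMER-MAP.md`, not done here.  (ii) `hsolν`, (I19) `hint`
stay DISPLAYED.  (iii) `k < K` where `HaarAC` of record is used.  (iv) Nothing of def-T ∕ K0e ∕ dag-n09-w6 ∕ lit-balaban re-proved — all consumed BY NAME.
-/

noncomputable section

open MeasureTheory Set Filter Topology
open scoped ENNReal NNReal
open Literature.MathematicalPhysics.QuantumFieldTheory
open Literature.MathematicalPhysics.QuantumFieldTheory.Balaban1983to89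
open Literature.MathematicalPhysics.QuantumFieldTheory.Balaban1983to89.Node00
open Literature.MathematicalPhysics.QuantumFieldTheory.Balaban1983to89.T4Continuum (T4Family)
open Literature.MathematicalPhysics.QuantumFieldTheory.Balaban1983to89.B12Eq019ActionBody (integrand integrand_apply nextAction nextAction_apply normConst
  normConst_def exp_nextAction normConst_mul_exp_nextAction)
open Literature.MathematicalPhysics.QuantumFieldTheory.Balaban1983to89.B12ContinuousTransportInvarianceOn (isOpen_domAltOfRecord continuous_dist1_SU)

namespace Summit.QuantumFields.YangMills.BalabanUVNodes.N09TransportPositiveOnDomainOfFibredChart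

/-! ## §1 Generic: a fibre integral of a non-negative integrand is positive as soon as the fibre measure charges its positivity set -/

section Generic

variable {α β Z : Type*} {Φ : α × Z → β} {J : α × Z → ℝ≥0} {ρ : β → ℝ}

/-- **POSITIVITY OF A FIBRE INTEGRAL FROM POSITIVE MASS OF THE POSITIVITY SET**: for `ρ ≥ 0` and the chart integrand `z ↦ J(V,z)·ρ(Φ(V,z))` integrable at `V`,
`0 < ∫ J(V,z)·ρ(Φ(V,z)) dτ(z)` as soon as `τ{z | J(V,z)·ρ(Φ(V,z)) > 0} > 0` (Mathlib `integral_pos_iff_support_of_nonneg_ae`).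
[cite: Balaban1987RG1, (2.10) p.267 (bookkeeping)] -/
theorem fibreIntegral_pos_of_measure_pos [MeasurableSpace Z] {τ : Measure Z} (V : α) (h0 : ∀ x, 0 ≤ ρ x)
    (hint : Integrable (fun z => (J (V, z) : ℝ) * ρ (Φ (V, z))) τ)
    (hpos : 0 < τ {z | 0 < (J (V, z) : ℝ) * ρ (Φ (V, z))}) :
    0 < ∫ z, (J (V, z) : ℝ) * ρ (Φ (V, z)) ∂τ := by
  have hnn : 0 ≤ᵐ[τ] fun z => (J (V, z) : ℝ) * ρ (Φ (V, z)) :=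
    Eventually.of_forall fun z => mul_nonneg (J (V, z)).coe_nonneg (h0 _)
  rw [integral_pos_iff_support_of_nonneg_ae hnn hint]
  exact hpos.trans_le (measure_mono fun z hz => Function.mem_support.2 (ne_of_gt hz))

/-- The two factors positive near `z₀` ⇒ the chart integrand positive near `z₀`. [cite: Balaban1987RG1, (2.10) p.267 (bookkeeping)] -/
theorem eventually_jacobian_mul_comp_pos [TopologicalSpace Z] {V : α} {z₀ : Z} (hJ : ∀ᶠ z in 𝓝 z₀, 0 < J (V, z))
    (hρ : ∀ᶠ z in 𝓝 z₀, 0 < ρ (Φ (V, z))) : ∀ᶠ z in 𝓝 z₀, 0 < (J (V, z) : ℝ) * ρ (Φ (V, z)) := by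
  filter_upwards [hJ, hρ] with z h1 h2 using mul_pos (NNReal.coe_pos.2 h1) h2

/-- **OPEN-POSITIVE FIBRE MEASURE**: a property holding NEAR ONE POINT `z₀` holds on a set of positive `τ`-measure (it contains an open neighbourhood of `z₀`).
[cite: Balaban1987RG1, (2.10) p.267 (bookkeeping)] -/
theorem measure_setOf_pos_of_eventually [TopologicalSpace Z] [MeasurableSpace Z] {τ : Measure Z} [τ.IsOpenPosMeasure] {p : Z → Prop} {z₀ : Z}
    (h : ∀ᶠ z in 𝓝 z₀, p z) : 0 < τ {z | p z} := by
  obtain ⟨O, hOp, hO, hz₀⟩ := mem_nhds_iff.1 h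
  exact (hO.measure_pos τ ⟨z₀, hz₀⟩).trans_le (measure_mono hOp)

/-- **… HENCE POSITIVITY OF THE FIBRE INTEGRAL FROM ONE GOOD FIBRE COORDINATE**: `ρ ≥ 0`, the chart integrand integrable at `V` and positive near some `z₀`, `τ`
open-positive ⇒ `0 < ∫ J(V,z)·ρ(Φ(V,z)) dτ(z)`. [cite: Balaban1987RG1, (2.10) p.267 (bookkeeping)] -/
theorem fibreIntegral_pos_of_eventually_pos [TopologicalSpace Z] [MeasurableSpace Z] {τ : Measure Z} [τ.IsOpenPosMeasure] (V : α)
    (h0 : ∀ x, 0 ≤ ρ x) (hint : Integrable (fun z => (J (V, z) : ℝ) * ρ (Φ (V, z))) τ) {z₀ : Z}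
    (hev : ∀ᶠ z in 𝓝 z₀, 0 < (J (V, z) : ℝ) * ρ (Φ (V, z))) :
    0 < ∫ z, (J (V, z) : ℝ) * ρ (Φ (V, z)) ∂τ :=
  fibreIntegral_pos_of_measure_pos V h0 hint (measure_setOf_pos_of_eventually hev)

end Generic

/-! ## §2 At the record: the β-transport of record `TcanOfRecord` (canonical version) is positive at EVERY point of an open set carrying a fibred chart -/

section Record

variable {F : T4Family} {N : ℕ} [NeZero N]
variable {Z : Type*} [MeasurableSpace Z] {τ : Measure Z} [SFinite τ]

/-- **★★ (F3), EVERYWHERE-ON-`U` EDITION, FROM A FIBRED CHART.**  DISPLAYED DATA (dag-n09-w6 g2's sockets, verbatim): a measurable chart `Φ : (coarse) × Z → (fine)`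
over the open set `U` on a set `S ⊇ {ρ ≠ 0}` with `Ū(Φ(V,z)) = V`, a σ-finite fibre measure `τ`, a measurable Jacobian `J`, the change-of-variables identity
`dU⌊(Ū⁻¹U ∩ S) = Φ_*((dV⌊U ⊗ τ)·J)`, the fibre integral continuous on `U`; PLUS per-`V` integrability of the chart integrand and positive `τ`-mass of its positivity set.
CONCLUSION: for `ρ ≥ 0` integrable and `k < K`, `0 < TcanOfRecord F N K k ρ V` at EVERY `V ∈ U` (the canonical version IS the fibre integral on `U`,
`Node00.TcanOfRecord_eqOn_fibreIntegral_of_fibredChart`; §1). [cite: Balaban1987RG1, (2.10) p.267, (0.13) p.254 and (0.19) p.255] -/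
theorem TcanOfRecord_pos_on_of_fibredChart {K k : ℕ} (hk : k < K) {ρ : Density (F.P K) k (SU N)}
    (hρ : Integrable ρ (fieldMeasure (F.P K) k (SU N))) (h0 : ∀ U, 0 ≤ ρ U) {U : Set (PBond (F.P K) (k + 1) → SU N)} (hU : IsOpen U)
    {S : Set (GaugeField (F.P K) k (SU N))} (hS : ∀ x, ρ x ≠ 0 → x ∈ S)
    {Φ : (PBond (F.P K) (k + 1) → SU N) × Z → GaugeField (F.P K) k (SU N)} {J : (PBond (F.P K) (k + 1) → SU N) × Z → ℝ≥0}
    (hΦ : Measurable Φ) (hJ : Measurable J) (havgΦ : ∀ V ∈ U, ∀ z, (avOfRecord F N K k).avg (Φ (V, z)) = V)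
    (hmap : (fieldMeasure (F.P K) k (SU N)).restrict ((avOfRecord F N K k).avg ⁻¹' U ∩ S)
      = ((((piHaar (F.P K) (k + 1) (SU N)).restrict U).prod τ).withDensity (fun p => (J p : ℝ≥0∞))).map Φ)
    (hgc : ContinuousOn (fun V => ∫ z, (J (V, z) : ℝ) * ρ (Φ (V, z)) ∂τ) U)
    (hintV : ∀ V ∈ U, Integrable (fun z => (J (V, z) : ℝ) * ρ (Φ (V, z))) τ)
    (hpos : ∀ V ∈ U, 0 < τ {z | 0 < (J (V, z) : ℝ) * ρ (Φ (V, z))}) :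
    ∀ V ∈ U, 0 < TcanOfRecord F N K k ρ V := by
  intro V hV
  have e : TcanOfRecord F N K k ρ V = ∫ z, (J (V, z) : ℝ) * ρ (Φ (V, z)) ∂τ :=
    (TcanOfRecord_eqOn_fibreIntegral_of_fibredChart hk hρ hU hS hΦ hJ havgΦ hmap hgc) hV
  rw [e]
  exact fibreIntegral_pos_of_measure_pos V h0 (hintV V hV) (hpos V hV)

/-- **★★ THE SAME WITH AN OPEN-POSITIVE FIBRE MEASURE AND A BASE POINT**: if, at each `V ∈ U`, the chart integrand is positive near some fibre coordinate `z₀ V`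
(for [I]'s (2.10) chart: `B₁ = 0`), then `0 < TcanOfRecord F N K k ρ V` for every `V ∈ U`. [cite: Balaban1987RG1, (2.10) p.267 and (0.19) p.255] -/
theorem TcanOfRecord_pos_on_of_fibredChart_of_eventually [TopologicalSpace Z] [τ.IsOpenPosMeasure] {K k : ℕ} (hk : k < K)
    {ρ : Density (F.P K) k (SU N)} (hρ : Integrable ρ (fieldMeasure (F.P K) k (SU N))) (h0 : ∀ U, 0 ≤ ρ U)
    {U : Set (PBond (F.P K) (k + 1) → SU N)} (hU : IsOpen U) {S : Set (GaugeField (F.P K) k (SU N))} (hS : ∀ x, ρ x ≠ 0 → x ∈ S)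
    {Φ : (PBond (F.P K) (k + 1) → SU N) × Z → GaugeField (F.P K) k (SU N)} {J : (PBond (F.P K) (k + 1) → SU N) × Z → ℝ≥0}
    (hΦ : Measurable Φ) (hJ : Measurable J) (havgΦ : ∀ V ∈ U, ∀ z, (avOfRecord F N K k).avg (Φ (V, z)) = V)
    (hmap : (fieldMeasure (F.P K) k (SU N)).restrict ((avOfRecord F N K k).avg ⁻¹' U ∩ S)
      = ((((piHaar (F.P K) (k + 1) (SU N)).restrict U).prod τ).withDensity (fun p => (J p : ℝ≥0∞))).map Φ)
    (hgc : ContinuousOn (fun V => ∫ z, (J (V, z) : ℝ) * ρ (Φ (V, z)) ∂τ) U)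
    (hintV : ∀ V ∈ U, Integrable (fun z => (J (V, z) : ℝ) * ρ (Φ (V, z))) τ)
    (z₀ : (PBond (F.P K) (k + 1) → SU N) → Z) (hev : ∀ V ∈ U, ∀ᶠ z in 𝓝 (z₀ V), 0 < (J (V, z) : ℝ) * ρ (Φ (V, z))) :
    ∀ V ∈ U, 0 < TcanOfRecord F N K k ρ V :=
  TcanOfRecord_pos_on_of_fibredChart hk hρ h0 hU hS hΦ hJ havgΦ hmap hgc hintV fun V hV => measure_setOf_pos_of_eventually (hev V hV)

end Record

/-! ## §3 At the β-input of record `ρ_k = χ^{(2.9)}_k · exp[−GF_k∕g_k² + A_k]`: the chart's base point — the critical configuration — is a positivity witness -/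

section BetaInput

variable {F : T4Family} {N : ℕ} [NeZero N]

/-- Unfolding the β-input at the (2.9) species: `ρ_k(U) = χ^{(2.9)}_k(U)·exp[−GF_k(U)∕g_k² + A_k(U)]`. [cite: Balaban1987RG1, (0.19) p.255 and (2.9) p.266 (bookkeeping)] -/
theorem betaInput_chi29_apply (ν : Stage7Numerics) (ε₁ : ℝ) (T : Transport F N) (K : ℕ) (g : ℕ → ℝ) (k : ℕ) (U : GaugeField (F.P K) k (SU N)) :
    betaInputOfRecord F N T (chiFixed29 F N ν ε₁) K g k U
      = chiFix29OfRecord F N ν ε₁ K k U * Real.exp (-(1 / (g k) ^ 2) * gfOfRecord F N K k U + effActionHT F N T (chiFixed29 F N ν ε₁) K g k U) := rfl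

/-- The β-input at the (2.9) species is non-negative (`χ^{(2.9)} ∈ {0,1}`, `exp > 0`). [cite: Balaban1987RG1, (0.19) p.255 (bookkeeping)] -/
theorem betaInput_chi29_nonneg (ν : Stage7Numerics) (ε₁ : ℝ) (T : Transport F N) (K : ℕ) (g : ℕ → ℝ) (k : ℕ) (U : GaugeField (F.P K) k (SU N)) :
    0 ≤ betaInputOfRecord F N T (chiFixed29 F N ν ε₁) K g k U := by
  rw [betaInput_chi29_apply]
  exact mul_nonneg (chiFix29OfRecord_mem_Icc ν ε₁ K k U).1 (Real.exp_pos _).le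

/-- **The β-input is POSITIVE exactly where `χ^{(2.9)}_k = 1`.** [cite: Balaban1987RG1, (0.19) p.255 and (2.9) p.266] -/
theorem betaInput_chi29_pos_iff (ν : Stage7Numerics) (ε₁ : ℝ) (T : Transport F N) (K : ℕ) (g : ℕ → ℝ) (k : ℕ) (U : GaugeField (F.P K) k (SU N)) :
    0 < betaInputOfRecord F N T (chiFixed29 F N ν ε₁) K g k U ↔ chiFix29OfRecord F N ν ε₁ K k U = 1 := by
  rw [betaInput_chi29_apply]
  rcases chiFix29OfRecord_eq_zero_or_one ν ε₁ K k U with h | h <;> rw [h]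
  · simp
  · simp [Real.exp_pos]

/-- **★ EVERY FLUCTUATION VARIABLE OF THE CRITICAL CONFIGURATION VANISHES** (solvable `W`): `V^{(k)}(W)` lies in the fibre over `W` (`Node00.avg_critCfgOfRecord`), so its
deviation from the critical configuration over ITS OWN average is `dist1(V^{(k)}(W)(b)⁻¹·V^{(k)}(W)(b)) = dist1 1 = 0` — print's `B′ = 0` at `V = V^{(k)}`.
[cite: Balaban1987RG1, (2.1)–(2.3) p.265 and (2.9) p.266] -/
theorem fluctDevOfRecord_critCfgOfRecord (ν : Stage7Numerics) {K k : ℕ} {W : GaugeField (F.P K) (k + 1) (SU N)}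
    (hW : UkExists F N K (k + 1) ν.εreg W) (b : PBond (F.P K) k) :
    fluctDevOfRecord F N ν K k (critCfgOfRecord F N ν K k W) b = 0 := by
  rw [fluctDevOfRecord_apply, avg_critCfgOfRecord hW, inv_mul_cancel, GaugeGroup.dist1_one]

/-- **★ `χ^{(2.9)}_k(V^{(k)}(W)) = 1` ON THE SOLVABLE SET** (`0 < ε₁`; dag-n13-w1's `chiFix29OfRecord_critCfgOfRecord_one` is the `W = 1` case). [cite: Balaban1987RG1, (2.9) p.266 and (2.3) p.265] -/
theorem chiFix29OfRecord_critCfgOfRecord_eq_one (ν : Stage7Numerics) {ε₁ : ℝ} (hε : 0 < ε₁) {K k : ℕ} {W : GaugeField (F.P K) (k + 1) (SU N)}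
    (hW : UkExists F N K (k + 1) ν.εreg W) : chiFix29OfRecord F N ν ε₁ K k (critCfgOfRecord F N ν K k W) = 1 :=
  (chiFix29OfRecord_eq_one_iff ν ε₁ K k _).2 fun b _ => by
    rw [fluctDevOfRecord_critCfgOfRecord ν hW b]; exact hε

/-- Hence the β-input is POSITIVE at the critical configuration over every solvable coarse field. [cite: Balaban1987RG1, (0.19) p.255, (2.3) p.265 and (2.9) p.266] -/
theorem betaInput_chi29_critCfgOfRecord_pos (ν : Stage7Numerics) {ε₁ : ℝ} (hε : 0 < ε₁) (T : Transport F N) (K : ℕ) (g : ℕ → ℝ) {k : ℕ}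
    {W : GaugeField (F.P K) (k + 1) (SU N)} (hW : UkExists F N K (k + 1) ν.εreg W) :
    0 < betaInputOfRecord F N T (chiFixed29 F N ν ε₁) K g k (critCfgOfRecord F N ν K k W) :=
  (betaInput_chi29_pos_iff ν ε₁ T K g k _).2 (chiFix29OfRecord_critCfgOfRecord_eq_one ν hε hW)

/-- **ALONG THE FIBRE OVER `V` THE REFERENCE CONFIGURATION IS FIXED**: if `Ū(U) = V` then `fluctDev_k(U)(b) = dist1(V^{(k)}(V)(b)⁻¹·U(b))`.
[cite: Balaban1987RG1, (2.1) p.265 and (2.9) p.266 (bookkeeping)] -/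
theorem fluctDevOfRecord_eq_of_avg_eq (ν : Stage7Numerics) {K k : ℕ} {U : GaugeField (F.P K) k (SU N)} {V : GaugeField (F.P K) (k + 1) (SU N)}
    (hUV : (avOfRecord F N K k).avg U = V) (b : PBond (F.P K) k) :
    fluctDevOfRecord F N ν K k U b = dist1 ((critCfgOfRecord F N ν K k V b)⁻¹ * U b) := by
  rw [fluctDevOfRecord_apply, hUV]

variable {Z : Type*} [TopologicalSpace Z]

/-- **THE DEVIATIONS ARE CONTINUOUS ALONG A CHART CONTINUOUS IN THE FIBRE COORDINATE** (the reference `V^{(k)}(V)` is constant along the fibre; `dist1` and the group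
operations of `SU(N)` are continuous). [cite: Balaban1987RG1, (2.9) p.266 and (2.10) p.267 (bookkeeping)] -/
theorem continuousAt_fluctDevOfRecord_chart (ν : Stage7Numerics) {K k : ℕ}
    {Φ : (PBond (F.P K) (k + 1) → SU N) × Z → GaugeField (F.P K) k (SU N)} {V : PBond (F.P K) (k + 1) → SU N}
    (havgΦ : ∀ z, (avOfRecord F N K k).avg (Φ (V, z)) = V) {z₀ : Z} (hΦc : ContinuousAt (fun z => Φ (V, z)) z₀) (b : PBond (F.P K) k) :
    ContinuousAt (fun z => fluctDevOfRecord F N ν K k (Φ (V, z)) b) z₀ := by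
  have e : (fun z => fluctDevOfRecord F N ν K k (Φ (V, z)) b) = fun z => dist1 ((critCfgOfRecord F N ν K k V b)⁻¹ * Φ (V, z) b) := by
    funext z
    exact fluctDevOfRecord_eq_of_avg_eq ν (havgΦ z) b
  rw [e]
  have hb : ContinuousAt (fun z => Φ (V, z) b) z₀ := ((continuous_apply b).continuousAt).comp hΦc
  exact continuous_dist1_SU.continuousAt.comp (continuousAt_const.mul hb)

/-- **★ NEAR ITS BASE POINT THE CHART STAYS INSIDE `{χ^{(2.9)}_k = 1}`**: if `Φ(V,·)` is continuous at `z₀` with `Φ(V, z₀) = V^{(k)}(V)`, `V` solvable and `0 < ε₁`,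
then `χ^{(2.9)}_k(Φ(V,z)) = 1` for all `z` near `z₀` (each of the finitely many deviations is continuous and `= 0 < ε₁` at `z₀`).
[cite: Balaban1987RG1, (2.9) p.266 and (2.10) p.267] -/
theorem eventually_chiFix29OfRecord_chart_eq_one (ν : Stage7Numerics) {ε₁ : ℝ} (hε : 0 < ε₁) {K k : ℕ}
    {Φ : (PBond (F.P K) (k + 1) → SU N) × Z → GaugeField (F.P K) k (SU N)} {V : PBond (F.P K) (k + 1) → SU N}
    (hsol : UkExists F N K (k + 1) ν.εreg V) (havgΦ : ∀ z, (avOfRecord F N K k).avg (Φ (V, z)) = V) {z₀ : Z}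
    (hΦc : ContinuousAt (fun z => Φ (V, z)) z₀) (hz₀ : Φ (V, z₀) = critCfgOfRecord F N ν K k V) :
    ∀ᶠ z in 𝓝 z₀, chiFix29OfRecord F N ν ε₁ K k (Φ (V, z)) = 1 := by
  have hall : ∀ᶠ z in 𝓝 z₀, ∀ b : PBond (F.P K) k, fluctDevOfRecord F N ν K k (Φ (V, z)) b < ε₁ := by
    refine eventually_all.2 fun b => ?_
    have h0 : fluctDevOfRecord F N ν K k (Φ (V, z₀)) b < ε₁ := by
      rw [hz₀, fluctDevOfRecord_critCfgOfRecord ν hsol b]; exact hε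
    exact (continuousAt_fluctDevOfRecord_chart ν havgΦ hΦc b).eventually_mem (Iio_mem_nhds h0)
  filter_upwards [hall] with z hz
  exact (chiFix29OfRecord_eq_one_iff ν ε₁ K k _).2 fun b _ => hz b

/-- … hence the β-input is POSITIVE along the chart near its base point. [cite: Balaban1987RG1, (0.19) p.255, (2.9) p.266 and (2.10) p.267] -/
theorem eventually_betaInput_chi29_chart_pos (ν : Stage7Numerics) {ε₁ : ℝ} (hε : 0 < ε₁) (T : Transport F N) (K : ℕ) (g : ℕ → ℝ) {k : ℕ}
    {Φ : (PBond (F.P K) (k + 1) → SU N) × Z → GaugeField (F.P K) k (SU N)} {V : PBond (F.P K) (k + 1) → SU N}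
    (hsol : UkExists F N K (k + 1) ν.εreg V) (havgΦ : ∀ z, (avOfRecord F N K k).avg (Φ (V, z)) = V) {z₀ : Z}
    (hΦc : ContinuousAt (fun z => Φ (V, z)) z₀) (hz₀ : Φ (V, z₀) = critCfgOfRecord F N ν K k V) :
    ∀ᶠ z in 𝓝 z₀, 0 < betaInputOfRecord F N T (chiFixed29 F N ν ε₁) K g k (Φ (V, z)) := by
  filter_upwards [eventually_chiFix29OfRecord_chart_eq_one ν hε hsol havgΦ hΦc hz₀] with z hz
  exact (betaInput_chi29_pos_iff ν ε₁ T K g k _).2 hz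

variable [MeasurableSpace Z]

/-- **★★★ (F3), EVERYWHERE ON THE NEXT SMALL-FIELD DOMAIN, AT THE β-INPUT OF RECORD.**  For a Stage-13 parameter `θ`, a run `P` and a step `j < P.K`, let
`ρ_j = betaInputOfRecord (TβOfRecord₁₃) (chiβOfRecord₁₃ θ) P.K (gOfRecord₁₃ θ P) j` (integrable: (I19) `hint`, the doors' own).  DISPLAYED: dag-n09-w6 g2's fibred-chart
sockets of the averaging of record over `domAltOfRecord θ.ν P.K (j+1)` on a set `S ⊇ {ρ_j ≠ 0}` (`hΦ hJ havgΦ hmap hgc`), per-`V` integrability of the chart integrand, an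
OPEN-POSITIVE fibre measure `τ`, and print's base point of (2.10): `Φ(V, z₀ V) = V^{(j)}(V)` with `Φ(V,·)` continuous there and `J(V,·) > 0` nearby; [B11] solvability
on the domain (`hsolν`); `0 < θ.ε₂₉`.  CONCLUSION: `0 < TβOfRecord₁₃ F N P.K j ρ_j V` at EVERY `V ∈ domAltOfRecord θ.ν P.K (j+1)` — the β-transport of record of the
(0.19) density is strictly positive on the whole next small-field domain, not only a.e.  Nothing of Bałaban's asserted.
[cite: Balaban1987RG1, (2.10) p.267, (2.3) p.265, (2.9) p.266, (0.19) p.255 and p.259] -/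
theorem TβOfRecord₁₃_betaInput_pos_on_domAlt_of_fibredChart (θ : Stage13Params F N) (P : B12.RunParams) {j : ℕ} (hj : j < P.K)
    (hε : 0 < θ.ε₂₉) (hsolν : ∀ W ∈ domAltOfRecord F N θ.ν P.K (j + 1), UkExists F N P.K (j + 1) θ.ν.εreg W)
    (hint : Integrable (betaInputOfRecord F N (TβOfRecord₁₃ F N) (chiβOfRecord₁₃ F N θ) P.K (gOfRecord₁₃ F N θ P) j) (fieldMeasure (F.P P.K) j (SU N)))
    (τ : Measure Z) [SFinite τ] [τ.IsOpenPosMeasure]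
    (S : Set (GaugeField (F.P P.K) j (SU N)))
    (hS : ∀ x, betaInputOfRecord F N (TβOfRecord₁₃ F N) (chiβOfRecord₁₃ F N θ) P.K (gOfRecord₁₃ F N θ P) j x ≠ 0 → x ∈ S)
    (Φ : (PBond (F.P P.K) (j + 1) → SU N) × Z → GaugeField (F.P P.K) j (SU N)) (J : (PBond (F.P P.K) (j + 1) → SU N) × Z → ℝ≥0)
    (hΦ : Measurable Φ) (hJ : Measurable J) (havgΦ : ∀ V ∈ domAltOfRecord F N θ.ν P.K (j + 1), ∀ z, (avOfRecord F N P.K j).avg (Φ (V, z)) = V)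
    (hmap : (fieldMeasure (F.P P.K) j (SU N)).restrict ((avOfRecord F N P.K j).avg ⁻¹' domAltOfRecord F N θ.ν P.K (j + 1) ∩ S)
      = ((((piHaar (F.P P.K) (j + 1) (SU N)).restrict (domAltOfRecord F N θ.ν P.K (j + 1))).prod τ).withDensity
          (fun p => (J p : ℝ≥0∞))).map Φ)
    (hgc : ContinuousOn (fun V => ∫ z, (J (V, z) : ℝ) *
      betaInputOfRecord F N (TβOfRecord₁₃ F N) (chiβOfRecord₁₃ F N θ) P.K (gOfRecord₁₃ F N θ P) j (Φ (V, z)) ∂τ) (domAltOfRecord F N θ.ν P.K (j + 1)))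
    (hintV : ∀ V ∈ domAltOfRecord F N θ.ν P.K (j + 1), Integrable (fun z => (J (V, z) : ℝ) *
      betaInputOfRecord F N (TβOfRecord₁₃ F N) (chiβOfRecord₁₃ F N θ) P.K (gOfRecord₁₃ F N θ P) j (Φ (V, z))) τ)
    (z₀ : (PBond (F.P P.K) (j + 1) → SU N) → Z)
    (hz₀ : ∀ V ∈ domAltOfRecord F N θ.ν P.K (j + 1), Φ (V, z₀ V) = critCfgOfRecord F N θ.ν P.K j V)
    (hΦc : ∀ V ∈ domAltOfRecord F N θ.ν P.K (j + 1), ContinuousAt (fun z => Φ (V, z)) (z₀ V))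
    (hJpos : ∀ V ∈ domAltOfRecord F N θ.ν P.K (j + 1), ∀ᶠ z in 𝓝 (z₀ V), 0 < J (V, z)) :
    ∀ V ∈ domAltOfRecord F N θ.ν P.K (j + 1),
      0 < TβOfRecord₁₃ F N P.K j (betaInputOfRecord F N (TβOfRecord₁₃ F N) (chiβOfRecord₁₃ F N θ) P.K (gOfRecord₁₃ F N θ P) j) V :=
  TcanOfRecord_pos_on_of_fibredChart_of_eventually hj hint (betaInput_chi29_nonneg θ.ν θ.ε₂₉ _ P.K _ j)
    (isOpen_domAltOfRecord θ.ν P.K (j + 1)) hS hΦ hJ havgΦ hmap hgc hintV z₀ fun V hV =>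
      eventually_jacobian_mul_comp_pos (hJpos V hV)
        (eventually_betaInput_chi29_chart_pos θ.ν hε _ P.K _ (hsolν V hV) (havgΦ V hV) (hΦc V hV) (hz₀ V hV))

end BetaInput

/-! ## §4 The log-at-zero corner: `A_{k+1} = log 𝐍_k⁻¹ T_k ρ_k` is continuous where `T_k ρ_k` is continuous AND positive; (0.19) on the domain -/

section LogCorner

/-- **GENERIC (`Setup` level): the body (0.19) `nextAction = log(𝐍⁻¹·Tρ)` is continuous on any set on which `Tρ` is continuous and non-vanishing**
(`Real.log` is continuous off `0`; the junk branch `𝐍⁻¹ = 0` gives a constant). [cite: Balaban1987RG1, (0.19) p.255 (bookkeeping)] -/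
theorem continuousOn_nextAction_of_ne_zero {P : Params} {G : Type*} [GaugeGroup G] [TopologicalSpace G] {k : ℕ}
    (T : Density P k G → Density P (k + 1) G) (χ GF : Density P k G) (gk : ℝ) (A : Density P k G) {D : Set (GaugeField P (k + 1) G)}
    (hT : ContinuousOn (T (integrand χ GF gk A)) D) (hne : ∀ V ∈ D, T (integrand χ GF gk A) V ≠ 0) :
    ContinuousOn (nextAction T χ GF gk A) D := by
  have e : nextAction T χ GF gk A = fun V => Real.log ((normConst T χ GF gk A)⁻¹ * T (integrand χ GF gk A) V) := rfl
  rw [e]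
  by_cases hN : (normConst T χ GF gk A)⁻¹ = 0
  · simp only [hN, zero_mul, Real.log_zero]
    exact continuousOn_const
  · exact (continuousOn_const.mul hT).log fun V hV => mul_ne_zero hN (hne V hV)

variable {F : T4Family} {N : ℕ} [NeZero N]

/-- **★★ THE LOG-AT-ZERO CORNER AT THE RECORD** (β-transport `TcanOfRecord`, any χ, any history): if a set `D` of coarse fields lies in the maximal regular set of the
transform of the step-`k` β-input (`hreg`'s shape at one step — there `TcanOfRecord` is continuous, K0e's `continuousOn_TcanOfRecord`) and that transform is
POSITIVE on `D`, then the next effective action `A_{k+1} = effActionHT … (k+1)` is CONTINUOUS ON `D`. [cite: Balaban1987RG1, (0.19) p.255, (0.13) p.254 and p.259] -/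
theorem continuousOn_effActionHT_succ_of_subset_regSetOfRecord_of_pos (χ : (K : ℕ) → (ℕ → ℝ) → (k : ℕ) → Density (F.P K) k (SU N)) (K : ℕ) (g : ℕ → ℝ)
    (k : ℕ) {D : Set (GaugeField (F.P K) (k + 1) (SU N))}
    (hreg : D ⊆ regSetOfRecord F N K k (betaInputOfRecord F N (TcanOfRecord F N) χ K g k))
    (hpos : ∀ V ∈ D, 0 < TcanOfRecord F N K k (betaInputOfRecord F N (TcanOfRecord F N) χ K g k) V) :
    ContinuousOn (effActionHT F N (TcanOfRecord F N) χ K g (k + 1)) D := by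
  rw [effActionHT_succ]
  exact continuousOn_nextAction_of_ne_zero _ _ _ _ _ ((continuousOn_TcanOfRecord K k _).mono hreg) fun V hV => (hpos V hV).ne'

variable {Z : Type*} [TopologicalSpace Z] [MeasurableSpace Z]

/-- **★★★ `A_{j+1}` IS CONTINUOUS ON `domAlt_{j+1}` FROM THE STEP-`j` CHART ALONE**: with the fibred chart of §3 over `domAltOfRecord θ.ν P.K (j+1)` through the critical
configuration, `hsolν`, `0 < θ.ε₂₉` and (I19) `hint`, BOTH inputs of the corner are theorems — `hreg_j` by dag-n09-w6 g2's `Node00.domAlt_subset_regSetOfRecord_of_fibredChart`,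
positivity by `TβOfRecord₁₃_betaInput_pos_on_domAlt_of_fibredChart` — so `effActionHT (TβOfRecord₁₃) (chiβOfRecord₁₃ θ) P.K (gOfRecord₁₃ θ P) (j+1)` is continuous on
`domAltOfRecord θ.ν P.K (j+1)`: the `A_{j+1}∘Φ_{j+1}` part of the smooth-factor hypothesis `hg` of `Node00.continuousOn_fibreIntegral_betaInput_chiFixed29_of_thresholdNull`
at the NEXT step ((F1)'s induction reads (F3)).  CONDITIONAL on the displayed chart; nothing of Bałaban's asserted. [cite: Balaban1987RG1, (0.19) p.255, p.259 and (2.10) p.267] -/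
theorem continuousOn_effActionHT_succ_domAlt_of_fibredChart (θ : Stage13Params F N) (P : B12.RunParams) {j : ℕ} (hj : j < P.K)
    (hε : 0 < θ.ε₂₉) (hsolν : ∀ W ∈ domAltOfRecord F N θ.ν P.K (j + 1), UkExists F N P.K (j + 1) θ.ν.εreg W)
    (hint : Integrable (betaInputOfRecord F N (TβOfRecord₁₃ F N) (chiβOfRecord₁₃ F N θ) P.K (gOfRecord₁₃ F N θ P) j) (fieldMeasure (F.P P.K) j (SU N)))
    (τ : Measure Z) [SFinite τ] [τ.IsOpenPosMeasure]
    (S : Set (GaugeField (F.P P.K) j (SU N)))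
    (hS : ∀ x, betaInputOfRecord F N (TβOfRecord₁₃ F N) (chiβOfRecord₁₃ F N θ) P.K (gOfRecord₁₃ F N θ P) j x ≠ 0 → x ∈ S)
    (Φ : (PBond (F.P P.K) (j + 1) → SU N) × Z → GaugeField (F.P P.K) j (SU N)) (J : (PBond (F.P P.K) (j + 1) → SU N) × Z → ℝ≥0)
    (hΦ : Measurable Φ) (hJ : Measurable J) (havgΦ : ∀ V ∈ domAltOfRecord F N θ.ν P.K (j + 1), ∀ z, (avOfRecord F N P.K j).avg (Φ (V, z)) = V)
    (hmap : (fieldMeasure (F.P P.K) j (SU N)).restrict ((avOfRecord F N P.K j).avg ⁻¹' domAltOfRecord F N θ.ν P.K (j + 1) ∩ S)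
      = ((((piHaar (F.P P.K) (j + 1) (SU N)).restrict (domAltOfRecord F N θ.ν P.K (j + 1))).prod τ).withDensity
          (fun p => (J p : ℝ≥0∞))).map Φ)
    (hgc : ContinuousOn (fun V => ∫ z, (J (V, z) : ℝ) *
      betaInputOfRecord F N (TβOfRecord₁₃ F N) (chiβOfRecord₁₃ F N θ) P.K (gOfRecord₁₃ F N θ P) j (Φ (V, z)) ∂τ) (domAltOfRecord F N θ.ν P.K (j + 1)))
    (hintV : ∀ V ∈ domAltOfRecord F N θ.ν P.K (j + 1), Integrable (fun z => (J (V, z) : ℝ) *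
      betaInputOfRecord F N (TβOfRecord₁₃ F N) (chiβOfRecord₁₃ F N θ) P.K (gOfRecord₁₃ F N θ P) j (Φ (V, z))) τ)
    (z₀ : (PBond (F.P P.K) (j + 1) → SU N) → Z)
    (hz₀ : ∀ V ∈ domAltOfRecord F N θ.ν P.K (j + 1), Φ (V, z₀ V) = critCfgOfRecord F N θ.ν P.K j V)
    (hΦc : ∀ V ∈ domAltOfRecord F N θ.ν P.K (j + 1), ContinuousAt (fun z => Φ (V, z)) (z₀ V))
    (hJpos : ∀ V ∈ domAltOfRecord F N θ.ν P.K (j + 1), ∀ᶠ z in 𝓝 (z₀ V), 0 < J (V, z)) :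
    ContinuousOn (effActionHT F N (TβOfRecord₁₃ F N) (chiβOfRecord₁₃ F N θ) P.K (gOfRecord₁₃ F N θ P) (j + 1)) (domAltOfRecord F N θ.ν P.K (j + 1)) :=
  continuousOn_effActionHT_succ_of_subset_regSetOfRecord_of_pos _ P.K _ j
    (domAlt_subset_regSetOfRecord_of_fibredChart θ.ν hj hint hS hΦ hJ havgΦ hmap hgc)
    (TβOfRecord₁₃_betaInput_pos_on_domAlt_of_fibredChart θ P hj hε hsolν hint τ S hS Φ J hΦ hJ havgΦ hmap hgc hintV z₀ hz₀ hΦc hJpos)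

/-- **★★ THE NORMALISATION CONSTANT `𝐍_j = T_jρ_j(1)` IS POSITIVE** from the same chart (the unit configuration lies in every small-field domain of record when `0 < ν.ε₀`,
K0e's `one_mem_domAltOfRecord`). [cite: Balaban1987RG1, (0.19) p.255–256 and p.259] -/
theorem normConstHT_pos_of_fibredChart (θ : Stage13Params F N) (P : B12.RunParams) {j : ℕ} (hj : j < P.K) (hε₀ : 0 < θ.ν.ε₀)
    (hε : 0 < θ.ε₂₉) (hsolν : ∀ W ∈ domAltOfRecord F N θ.ν P.K (j + 1), UkExists F N P.K (j + 1) θ.ν.εreg W)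
    (hint : Integrable (betaInputOfRecord F N (TβOfRecord₁₃ F N) (chiβOfRecord₁₃ F N θ) P.K (gOfRecord₁₃ F N θ P) j) (fieldMeasure (F.P P.K) j (SU N)))
    (τ : Measure Z) [SFinite τ] [τ.IsOpenPosMeasure]
    (S : Set (GaugeField (F.P P.K) j (SU N)))
    (hS : ∀ x, betaInputOfRecord F N (TβOfRecord₁₃ F N) (chiβOfRecord₁₃ F N θ) P.K (gOfRecord₁₃ F N θ P) j x ≠ 0 → x ∈ S)
    (Φ : (PBond (F.P P.K) (j + 1) → SU N) × Z → GaugeField (F.P P.K) j (SU N)) (J : (PBond (F.P P.K) (j + 1) → SU N) × Z → ℝ≥0)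
    (hΦ : Measurable Φ) (hJ : Measurable J) (havgΦ : ∀ V ∈ domAltOfRecord F N θ.ν P.K (j + 1), ∀ z, (avOfRecord F N P.K j).avg (Φ (V, z)) = V)
    (hmap : (fieldMeasure (F.P P.K) j (SU N)).restrict ((avOfRecord F N P.K j).avg ⁻¹' domAltOfRecord F N θ.ν P.K (j + 1) ∩ S)
      = ((((piHaar (F.P P.K) (j + 1) (SU N)).restrict (domAltOfRecord F N θ.ν P.K (j + 1))).prod τ).withDensity
          (fun p => (J p : ℝ≥0∞))).map Φ)
    (hgc : ContinuousOn (fun V => ∫ z, (J (V, z) : ℝ) *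
      betaInputOfRecord F N (TβOfRecord₁₃ F N) (chiβOfRecord₁₃ F N θ) P.K (gOfRecord₁₃ F N θ P) j (Φ (V, z)) ∂τ) (domAltOfRecord F N θ.ν P.K (j + 1)))
    (hintV : ∀ V ∈ domAltOfRecord F N θ.ν P.K (j + 1), Integrable (fun z => (J (V, z) : ℝ) *
      betaInputOfRecord F N (TβOfRecord₁₃ F N) (chiβOfRecord₁₃ F N θ) P.K (gOfRecord₁₃ F N θ P) j (Φ (V, z))) τ)
    (z₀ : (PBond (F.P P.K) (j + 1) → SU N) → Z)
    (hz₀ : ∀ V ∈ domAltOfRecord F N θ.ν P.K (j + 1), Φ (V, z₀ V) = critCfgOfRecord F N θ.ν P.K j V)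
    (hΦc : ∀ V ∈ domAltOfRecord F N θ.ν P.K (j + 1), ContinuousAt (fun z => Φ (V, z)) (z₀ V))
    (hJpos : ∀ V ∈ domAltOfRecord F N θ.ν P.K (j + 1), ∀ᶠ z in 𝓝 (z₀ V), 0 < J (V, z)) :
    0 < normConstHT F N (TβOfRecord₁₃ F N) (chiβOfRecord₁₃ F N θ) P.K (gOfRecord₁₃ F N θ P) j :=
  TβOfRecord₁₃_betaInput_pos_on_domAlt_of_fibredChart θ P hj hε hsolν hint τ S hS Φ J hΦ hJ havgΦ hmap hgc hintV z₀ hz₀ hΦc hJpos 1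
    (one_mem_domAltOfRecord θ.ν hε₀ P.K (j + 1))

/-- **★★★ (0.19) ON THE DOMAIN: `T_jρ_j(V) = 𝐍_j · exp(A_{j+1}(V))` AT EVERY `V ∈ domAlt_{j+1}`** — print's sentence «∫dU δ(ŪV⁻¹)χ_j exp[…] = 𝐍_j exp A_{j+1}(V)» for the
record's objects on the small-field domain of the next step, from the chart (lit-balaban r20's `normConst_mul_exp_nextAction` with its two positivity hypotheses — at `V`
and at `1` — supplied by this file).  Off the domain nothing is claimed (the body `nextAction` is total; `exp ∘ log` is the identity only on the positivity set).
[cite: Balaban1987RG1, (0.19) p.255–256 and p.259] -/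
theorem TβOfRecord₁₃_betaInput_eq_normConst_mul_exp_effActionHT_on_domAlt (θ : Stage13Params F N) (P : B12.RunParams) {j : ℕ} (hj : j < P.K)
    (hε₀ : 0 < θ.ν.ε₀) (hε : 0 < θ.ε₂₉) (hsolν : ∀ W ∈ domAltOfRecord F N θ.ν P.K (j + 1), UkExists F N P.K (j + 1) θ.ν.εreg W)
    (hint : Integrable (betaInputOfRecord F N (TβOfRecord₁₃ F N) (chiβOfRecord₁₃ F N θ) P.K (gOfRecord₁₃ F N θ P) j) (fieldMeasure (F.P P.K) j (SU N)))
    (τ : Measure Z) [SFinite τ] [τ.IsOpenPosMeasure]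
    (S : Set (GaugeField (F.P P.K) j (SU N)))
    (hS : ∀ x, betaInputOfRecord F N (TβOfRecord₁₃ F N) (chiβOfRecord₁₃ F N θ) P.K (gOfRecord₁₃ F N θ P) j x ≠ 0 → x ∈ S)
    (Φ : (PBond (F.P P.K) (j + 1) → SU N) × Z → GaugeField (F.P P.K) j (SU N)) (J : (PBond (F.P P.K) (j + 1) → SU N) × Z → ℝ≥0)
    (hΦ : Measurable Φ) (hJ : Measurable J) (havgΦ : ∀ V ∈ domAltOfRecord F N θ.ν P.K (j + 1), ∀ z, (avOfRecord F N P.K j).avg (Φ (V, z)) = V)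
    (hmap : (fieldMeasure (F.P P.K) j (SU N)).restrict ((avOfRecord F N P.K j).avg ⁻¹' domAltOfRecord F N θ.ν P.K (j + 1) ∩ S)
      = ((((piHaar (F.P P.K) (j + 1) (SU N)).restrict (domAltOfRecord F N θ.ν P.K (j + 1))).prod τ).withDensity
          (fun p => (J p : ℝ≥0∞))).map Φ)
    (hgc : ContinuousOn (fun V => ∫ z, (J (V, z) : ℝ) *
      betaInputOfRecord F N (TβOfRecord₁₃ F N) (chiβOfRecord₁₃ F N θ) P.K (gOfRecord₁₃ F N θ P) j (Φ (V, z)) ∂τ) (domAltOfRecord F N θ.ν P.K (j + 1)))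
    (hintV : ∀ V ∈ domAltOfRecord F N θ.ν P.K (j + 1), Integrable (fun z => (J (V, z) : ℝ) *
      betaInputOfRecord F N (TβOfRecord₁₃ F N) (chiβOfRecord₁₃ F N θ) P.K (gOfRecord₁₃ F N θ P) j (Φ (V, z))) τ)
    (z₀ : (PBond (F.P P.K) (j + 1) → SU N) → Z)
    (hz₀ : ∀ V ∈ domAltOfRecord F N θ.ν P.K (j + 1), Φ (V, z₀ V) = critCfgOfRecord F N θ.ν P.K j V)
    (hΦc : ∀ V ∈ domAltOfRecord F N θ.ν P.K (j + 1), ContinuousAt (fun z => Φ (V, z)) (z₀ V))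
    (hJpos : ∀ V ∈ domAltOfRecord F N θ.ν P.K (j + 1), ∀ᶠ z in 𝓝 (z₀ V), 0 < J (V, z)) :
    ∀ V ∈ domAltOfRecord F N θ.ν P.K (j + 1),
      TβOfRecord₁₃ F N P.K j (betaInputOfRecord F N (TβOfRecord₁₃ F N) (chiβOfRecord₁₃ F N θ) P.K (gOfRecord₁₃ F N θ P) j) V
        = normConstHT F N (TβOfRecord₁₃ F N) (chiβOfRecord₁₃ F N θ) P.K (gOfRecord₁₃ F N θ P) j *
          Real.exp (effActionHT F N (TβOfRecord₁₃ F N) (chiβOfRecord₁₃ F N θ) P.K (gOfRecord₁₃ F N θ P) (j + 1) V) := by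
  intro V hV
  have hN := normConstHT_pos_of_fibredChart θ P hj hε₀ hε hsolν hint τ S hS Φ J hΦ hJ havgΦ hmap hgc hintV z₀ hz₀ hΦc hJpos
  have hVpos := TβOfRecord₁₃_betaInput_pos_on_domAlt_of_fibredChart θ P hj hε hsolν hint τ S hS Φ J hΦ hJ havgΦ hmap hgc hintV z₀ hz₀ hΦc hJpos V hV
  rw [effActionHT_succ]
  exact (normConst_mul_exp_nextAction _ _ _ _ _ hN hVpos).symm

end LogCorner

end Summit.QuantumFields.YangMills.BalabanUVNodes.N09TransportPositiveOnDomainOfFibredChart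

end
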